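import Summits.Ventures.QEC.Census.CertMitmK
import HarnessLib

/-!
# Controls for the generic KERNEL meet-in-the-middle lane `Census/CertMitmK.lean` (CERT-REQS A1; item 07.MITMK)

All by `decide` (KERNEL): the `[[4,2,2]]` certificate `certC422` (`CertCheck.lean`) through the depth-safe built
table and the representative tests (`MitmKX`); the completeness boundary
`2·wb > wmax` (self-lookups reject); Shor's `[[9,1,3]]` certificate `certShor9` (`CertControls.lean`, type-10),
`Z` side, where the three qubits of a block share one `X`-syndrome: search-9's injective table test (T1) FAILS on
the kernel-built table while (T1ᴿ)/(T3ᴿ) pass — with ONE table and with TWO TABLE PARTS assembled exactly as the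
emitted census files are (`reaches_origin_of_chunk1` per part for the probes, `reachesP_origin_of_chunk1` over
`coverP_origin` / `forall_coverP_of_chunk1RF` for the cover) — and `d_Z = 3` re-derived both ways.
Generic; axioms ⊆ {propext, Classical.choice, Quot.sound}; no `native_decide`.
-/

namespace Summit.Ventures.QEC.Census

open Literature.InformationTheory.QuantumCodes


/-- `[[4,2,2]]` (`certC422` of `CertCheck.lean`), `X` side, `(wa, wb) = (1, 0)`: the kernel-built table (part
`[0, 4)`, budget `0` = the empty pattern only) passes (T1ᴿ) from the origin. -/
theorem tableR_certC422 :
    scanF (tableTestR (tabFindQ (posList 4 certC422.HZ) 1 0 0 4) []) (posList 4 certC422.HZ) 0 0 0 = true := by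
  decide

/-- `[[4,2,2]]`, `X` side: every probe of `≤ 1` qubit passes (T3ᴿ) against that table. -/
theorem probeR_certC422 :
    scanF (probeTestR (tabFindQ (posList 4 certC422.HZ) 1 0 0 4) []) (posList 4 certC422.HZ) 1 0 0 = true := by
  decide

/-- `[[4,2,2]]`, `X` side: the cover obligation `MitmKX` of the generic lane holds (one table; from it
`dX_code_of_mitmK` re-derives `d_X = 2`, already in the tree as `dX_certC422_mitm`). -/
theorem mitmKX_certC422 : certC422.MitmKX [] 1 0 :=
  certC422.mitmKX_of_reaches (reaches_of_scan ((scanF_eq _ _ _ _ _).symm.trans tableR_certC422))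
    (reaches_of_scan ((scanF_eq _ _ _ _ _).symm.trans probeR_certC422))

/-- Completeness boundary (not a soundness matter): with `2·wb > wmax` the self-lookups can fail — `[[4,2,2]]`,
`X` side, `(0, 1)`: the four single qubits share one syndrome and differ pairwise by weight-2 LOGICALS, so (T1ᴿ)
rejects (as search-9's (T1) does, `CertCheckMitmFast.mitmXB_certC422_wb1`). -/
theorem tableR_certC422_wb1 :
    scanF (tableTestR (tabFindQ (posList 4 certC422.HZ) 1 1 0 4) []) (posList 4 certC422.HZ) 1 0 0 = false := by
  decide

/-- The structural check of the Shor certificate `certShor9` (`CertControls.lean`: `Z`-checks `Z₀Z₁, Z₁Z₂, Z₃Z₄,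
Z₄Z₅, Z₆Z₇, Z₇Z₈`, `X`-checks `X₀…X₅`, `X₃…X₈`, allow-list of side `Z` = the nine weight-2 `Z`-stabilizer words)
passes. -/
theorem checkStructure_certShor9 : certShor9.checkStructure = true := by decide

/-- Shor, `Z` side, `(wa, wb) = (1, 1)`, ONE kernel-built table: (T1ᴿ) passes although three tabled patterns share
each syndrome (two of the three meet the representative up to a weight-2 stabilizer). -/
theorem tableR_certShor9 :
    scanF (tableTestR (tabFindQ (posList 9 certShor9.HX) 2 1 0 9) (certShor9.sideZ.found.map Prod.fst))
      (posList 9 certShor9.HX) 1 0 0 = true := by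
  decide

/-- Shor, `Z` side: the injective-table lane (search-9's (T1) on search-7's kernel-built table, `DistCert.mitmZB` of
`CertCheckMitmFast.lean`) provably REJECTS the same side at the same split — the generalisation is needed. -/
theorem mitmZB_certShor9_fails : certShor9.mitmZB 1 1 = false := by
  decide

/-- Shor, `Z` side: every probe of `≤ 1` qubit passes (T3ᴿ). -/
theorem probeR_certShor9 :
    scanF (probeTestR (tabFindQ (posList 9 certShor9.HX) 2 1 0 9) (certShor9.sideZ.found.map Prod.fst))
      (posList 9 certShor9.HX) 1 0 0 = true := by
  decide

/-- **`d_Z = 3` for Shor's code through a non-injective kernel-built table**, CERTIFIED. -/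
theorem dZ_certShor9_mitmK :
    (certShor9.code (certShor9.commOK_of_checkStructure checkStructure_certShor9)).dZ = 3 :=
  certShor9.dZ_code_of_mitmK checkStructure_certShor9 rfl
    (certShor9.mitmKZ_of_reaches (reaches_of_scan ((scanF_eq _ _ _ _ _).symm.trans tableR_certShor9))
      (reaches_of_scan ((scanF_eq _ _ _ _ _).symm.trans probeR_certShor9)))

/-- Shor, `Z` side in TWO TABLE PARTS (first qubit in `[0, 5)` / in `[5, 9)`), the shape of the emitted files:
probes against part A pass … -/
theorem probeR_certShor9_partA :
    chunk1RF (probeTestR (tabFindQ (posList 9 certShor9.HX) 2 1 0 5) (certShor9.sideZ.found.map Prod.fst))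
      (posList 9 certShor9.HX) 0 0 9 = true := by
  decide

/-- … probes against part B pass … -/
theorem probeR_certShor9_partB :
    chunk1RF (probeTestR (tabFindQ (posList 9 certShor9.HX) 2 1 5 4) (certShor9.sideZ.found.map Prod.fst))
      (posList 9 certShor9.HX) 0 0 9 = true := by
  decide

/-- … the patterns with first qubit `< 5` are filed in part A … -/
theorem tableR_certShor9_partA :
    chunk1RF (tableTestR (tabFindQ (posList 9 certShor9.HX) 2 1 0 5) (certShor9.sideZ.found.map Prod.fst))
      (posList 9 certShor9.HX) 0 0 5 = true := by
  decide

/-- … those with first qubit `≥ 5` in part B … -/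
theorem tableR_certShor9_partB :
    chunk1RF (tableTestR (tabFindQ (posList 9 certShor9.HX) 2 1 5 4) (certShor9.sideZ.found.map Prod.fst))
      (posList 9 certShor9.HX) 0 5 4 = true := by
  decide

/-- … and the assembly (`reachesP_origin_of_chunk1` over `coverP_origin` and `forall_coverP_of_chunk1RF`, each
part with its own probe statement from `reaches_origin_of_chunk1`) gives `MitmKZ`, hence `d_Z = 3` again. -/
theorem dZ_certShor9_mitmK_parts :
    (certShor9.code (certShor9.commOK_of_checkStructure checkStructure_certShor9)).dZ = 3 :=
  have hA : Reaches (probeTestR (tabFindQ (posList 9 certShor9.HX) 2 1 0 5) (certShor9.sideZ.found.map Prod.fst))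
      (posList 9 certShor9.HX) 1 0 0 :=
    reaches_origin_of_chunk1 9 (by decide) (by decide)
      (forall_lt_append forall_lt_zero (forall_of_chunk1RF rfl probeR_certShor9_partA))
  have hB : Reaches (probeTestR (tabFindQ (posList 9 certShor9.HX) 2 1 5 4) (certShor9.sideZ.found.map Prod.fst))
      (posList 9 certShor9.HX) 1 0 0 :=
    reaches_origin_of_chunk1 9 (by decide) (by decide)
      (forall_lt_append forall_lt_zero (forall_of_chunk1RF rfl probeR_certShor9_partB))
  certShor9.dZ_code_of_mitmK checkStructure_certShor9 rfl
    (reachesP_origin_of_chunk1 9 (by decide) (coverP_origin _ (by decide) hA)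
      (forall_lt_append (forall_lt_append forall_lt_zero (forall_coverP_of_chunk1RF tableR_certShor9_partA hA))
        (forall_coverP_of_chunk1RF tableR_certShor9_partB hB)))

end Summit.Ventures.QEC.Census
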